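import Literature.NumberTheory.LFunctions.DobnerSelbergClassSeriesProofs
import Literature.NumberTheory.LFunctions.DobnerSelbergClassLemma3Proofs
import Literature.NumberTheory.LFunctions.DobnerTheorem4Proofs
import HarnessLib

/-!
# Dobner's §4.1 for `F ∈ 𝒮♯`: Thm. 4 (qualitative) from Lemma 4♯ — the summation step (proofs)

RH-FREE literature proofs (no new facts, no `def`s, no instances, no notation). Trunk T-ANT
(`Literature/NumberTheory/LFunctions`); node **N2-RED** (reduction form of N2) of the plan of record
for the discharge of `Literature.NumberTheory.LFunctions.dobner_theorem2` (HOME/drafts/rt/t7-N1-PLAN.md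
§4; rt-lead rulings (22)/(26)/(27), rt/STATUS 2026-08-26). Companion of
`DobnerSelbergClassSteepest.lean` (`J_t`, `γ_t`, `B_{t,n}`, the main term), of
`DobnerSelbergClassSeriesProofs.lean` (N1-a:
`Literature.NumberTheory.LFunctions.ExtendedSelbergDatum.xiDeformed_dobnerJ_eq_tsum`), of
`DobnerSelbergClassDeformed.lean` (`F_t = D.Ft`), of `DobnerSelbergClassLemma3Proofs.lean`
(`Literature.NumberTheory.LFunctions.ExtendedSelbergDatum.exists_norm_coeff_le`, `aₙ = O(n²)`), of
`DobnerLemma1Proofs.lean` (`Literature.NumberTheory.LFunctions.dobner_lemma1_holds`) and of the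
`ζ`-case file `DobnerTheorem4Proofs.lean`
(`Literature.NumberTheory.LFunctions.dobner_xiDeformed_approx_of_lemma4`), whose §4.1 argument is
ported here with the weight `aₙ`.

> A. Dobner, *A proof of Newman's conjecture for the extended Selberg class*, Acta Arith. 201
> (2021) = arXiv:2005.05142 (held; arXiv page numbers). **Thm. 4** (p. 8): "Let `F ∈ 𝒮♯`, let
> `F_t(s) := ∑ exp(−(|t|/4) log² n) aₙ n^{−s}` … If `−C ≤ t < 0` and `s = x + iy` where
> `|x| ≤ C y^{1/4}`, then `ξ^F_t(J_t(s)) = (1 + o(1)) γ_t(s) F_t(s) + o(|γ_t(s)|)`, as `y → ∞`".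
> **§4.1, "Proof of Theorem 4"** (pp. 13–14): "We have `ξ^F_t(J_t(s)) = ∑ aₙ B_{t,n}(s)`, and so
> by inserting the estimates for `B_{t,n}(s)` from Lemma 4 we get
> `γ_t(s) ∑_{n ≤ e^{y^{1/3}/|t|}} aₙ e^{−(|t|/4)log² n} n^{−s}(1 + O(y^{−1/5}))`
> `+ O(|γ_t(s)| ∑_{e^{y^{1/3}/|t|} < n ≤ e^{y^{3/5}/|t|}} |aₙ| e^{−(|t|/8)log² n} n^{−x})`
> `+ O(∑_{n > e^{y^{3/5}/|t|}} |aₙ| e^{−(|t|/10)log² n})`. … the first sum is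
> `γ_t(s)F_t(s) + O(|γ_t(s)| F̃_t(x) y^{−1/5}) + O(|γ_t(s)| ∑_{n > e^{y^{1/3}/|t|}} |aₙ| e^{−(|t|/4)log² n}
> n^{−x})` … `≪ ∑ |aₙ| n^{−y^{1/3}/8 + C}` … it suffices to show `≪ e^{−K′y}` for some `K′`, by
> Lemma 1" (eq. (4.9): `|γ_t(s)| = |γ(s)| e^{Re((s−J_t(s))²)/|t|} ≫ e^{−K′y}`).

## Main results (all `theorem`s; `D : ExtendedSelbergDatum`, `k = D.numGamma ≥ 1`, `t < 0`)

* `ExtendedSelbergDatum.xiDeformed_approx_of` — **N2 in hypothesis form**: from the conclusion of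
  Lemma 4♯ for every `C > 0` (hypothesis `hL4`, byte-for-byte the frozen statement of
  `ExtendedSelbergDatum.dobner_lemma4`, HOME/drafts/rt/t7-FROZEN-SIGNATURES.lean) to the
  qualitative Thm. 4 on vertical strips: for `a ≤ b`, `ε > 0` there is `y₀` with
  `‖ξ^F_t(J_t(s)) − γ_t(s) F_t(s)‖ ≤ ε ‖γ_t(s)‖` for `a ≤ Re s ≤ b`, `Im s ≥ y₀` (the frozen N2
  statement `ExtendedSelbergDatum.xiDeformed_approx` is then the one-liner
  `xiDeformed_approx_of D hk ht (fun C hC ↦ D.dobner_lemma4 hk ht hC)`);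
* `ExtendedSelbergDatum.exists_exp_neg_mul_le_norm_dobnerGammaT_of_re_mem` — **eq. (4.9)** on
  vertical strips: `c e^{−K′ Im s} ≤ ‖γ_t(s)‖` for `a ≤ Re s ≤ b`, `Im s ≥ y₁` (Lemma 1, lower half,
  `θ = 0`; the Gaussian factor is `≥ e^{−π²|t|(∑ωᵢ)²/4}` by `re_sq_sub_dobnerJ_div_ge`);
* the term-wise bounds of §4.1 with the weight `‖aₙ‖ ≤ C_a n²`:
  `norm_coeff_mul_sub_le_small` (Lemma 4 (i)/(ii) range) and `norm_coeff_mul_sub_le_large`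
  ((iii) range), and `coeff_mul_dobnerMainTerm_eq` (`aₙ · main term = γ_t(s) · (n-th term of F_t)`).

## Proof route (as printed, with the `ζ`-file's bookkeeping)

Exactly the `ζ`-case proof of `dobner_xiDeformed_approx_of_lemma4` with the extra weight
`‖aₙ‖ ≤ C_a n²` (`exists_norm_coeff_le`): every exponent threshold is raised by `2` (`p, q, r ≥ 4`
instead of `≥ 2`) and the medium/large tails are still dominated by `∑ n^{−2} ≤ 2`; the large-`n`
tail `e^{−(y^{3/5}/10 − 4) y^{3/5}/|t|}` divided by `‖γ_t(s)‖ ≥ c e^{−K′y}` still tends to `0`.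

bears_on: N-C/N-P (COLUMN 3 DBN). WHAT THIS IS NOT: the summation bookkeeping of the re-proof of a
published RH-free theorem (`Λ_F ≥ 0` on `𝒮♯`; the `ζ` case is the tree theorem
`Literature.NumberTheory.LFunctions.rodgers_tao_holds`); nothing here bears on the truth of RH.
-/

noncomputable section

open Complex Filter Set Topology Finset

namespace Literature.NumberTheory.LFunctions

namespace ExtendedSelbergDatum

variable (D : ExtendedSelbergDatum)

/-! ### The main terms `aₙ γ_t(s) e^{−(|t|/4)log² n} n^{−s}` -/

/-- `aₙ · (γ_t(s) e^{−(|t|/4)log² n} n^{−s}) = γ_t(s) · (n-th term of F_t at s)` (`t < 0`, `s ≠ 0`).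
[cite: Dobner2021, §4.1 p. 13] -/
theorem coeff_mul_dobnerMainTerm_eq {t : ℝ} (ht : t < 0) (n : ℕ) {s : ℂ} (hs : s ≠ 0) :
    D.coeff n * D.dobnerMainTerm t n s = D.dobnerGammaT t s * LSeries.term (D.deformedCoeff t) s n := by
  rw [D.dobnerMainTerm_eq ht n hs]
  rcases Nat.eq_zero_or_pos n with rfl | hn
  · simp [LSeries.term_zero]
  · rw [LSeries.term_of_ne_zero hn.ne', LSeries.term_of_ne_zero hn.ne', deformedCoeff]
    ring

/-- `‖aₙ · main term‖ ≤ ‖γ_t(s)‖ ‖n-th term of F_t at a‖` for `a ≤ Re s`. [cite: Dobner2021, §4.1 p. 13] -/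
theorem norm_coeff_mul_dobnerMainTerm_le {t : ℝ} (ht : t < 0) {s : ℂ} (hs0 : s ≠ 0) {a : ℝ}
    (ha : a ≤ s.re) (n : ℕ) :
    ‖D.coeff n * D.dobnerMainTerm t n s‖ ≤
      ‖D.dobnerGammaT t s‖ * ‖LSeries.term (D.deformedCoeff t) a n‖ := by
  rw [D.coeff_mul_dobnerMainTerm_eq ht n hs0, norm_mul]
  exact mul_le_mul_of_nonneg_left (LSeries.norm_term_le_of_re_le_re _ (by simpa using ha) n)
    (norm_nonneg _)

/-- `‖γ_t(s) e^{−(|t|/4)log² n} n^{−s}‖ = ‖γ_t(s)‖ e^{−(|t|/4)log² n} n^{−Re s}` for `n ≥ 1`.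
[cite: Dobner2021, Lemma 4 (i), p. 10] -/
theorem norm_dobnerMainTerm (t : ℝ) (s : ℂ) {n : ℕ} (hn : 1 ≤ n) :
    ‖D.dobnerMainTerm t n s‖ =
      ‖D.dobnerGammaT t s‖ * (Real.exp (-(|t| / 4) * Real.log n ^ 2) * (n : ℝ) ^ (-s.re)) := by
  rw [dobnerMainTerm, norm_mul, norm_mul, ← Complex.ofReal_neg, Complex.norm_exp_ofReal,
    Complex.norm_natCast_cpow_of_pos (by omega), Complex.neg_re, mul_assoc]
  congr 3
  ring

/-! ### Eq. (4.9): a lower bound for `‖γ_t(s)‖` on vertical strips -/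

/-- The Gaussian factor of `γ_t` is bounded below: `Re((s − J_t(s))²)/|t| ≥ −π²|t|(∑ωᵢ)²/4`
(`Im(s − J_t(s)) = −(|t|/2)∑ωᵢ arg(ωᵢ s + μᵢ)` has modulus `≤ (π|t|/2)∑ωᵢ`).
[cite: Dobner2021, §4.1 eq. (4.9), p. 14] -/
theorem re_sq_sub_dobnerJ_div_ge (t : ℝ) (s : ℂ) :
    -(Real.pi ^ 2 * |t| * D.omegaSum ^ 2 / 4) ≤ ((s - D.dobnerJ t s) ^ 2).re / |t| := by
  rcases eq_or_ne t 0 with rfl | ht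
  · simp
  have hτ : 0 < |t| := abs_pos.2 ht
  set S : ℝ := ∑ i, D.omega i * Complex.arg ((D.omega i : ℂ) * s + D.mu i) with hSdef
  have him : (s - D.dobnerJ t s).im = -(|t| / 2 * S) := by
    rw [Complex.sub_im, D.dobnerJ_im]; ring
  have hre : ((s - D.dobnerJ t s) ^ 2).re = (s - D.dobnerJ t s).re ^ 2 - (s - D.dobnerJ t s).im ^ 2 := by
    rw [sq, Complex.mul_re]; ring
  have hS : |S| ≤ Real.pi * D.omegaSum := by
    calc |S| ≤ ∑ i, |D.omega i * Complex.arg ((D.omega i : ℂ) * s + D.mu i)| :=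
          Finset.abs_sum_le_sum_abs _ _
      _ ≤ ∑ i, D.omega i * Real.pi := Finset.sum_le_sum fun i _ ↦ by
          rw [abs_mul, abs_of_pos (D.omega_pos i)]
          exact mul_le_mul_of_nonneg_left (Complex.abs_arg_le_pi _) (D.omega_pos i).le
      _ = Real.pi * D.omegaSum := by rw [omegaSum, Finset.mul_sum]; simp_rw [mul_comm]
  have hS2 : S ^ 2 ≤ (Real.pi * D.omegaSum) ^ 2 := sq_le_sq' (abs_le.1 hS).1 (abs_le.1 hS).2
  rw [hre, him, le_div_iff₀ hτ]
  have h1 : 0 ≤ (s - D.dobnerJ t s).re ^ 2 := sq_nonneg _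
  have h2 : (-(|t| / 2 * S)) ^ 2 = |t| ^ 2 / 4 * S ^ 2 := by ring
  rw [h2]
  have h3 := mul_le_mul_of_nonneg_left hS2 (by positivity : 0 ≤ |t| ^ 2 / 4)
  nlinarith

/-- **Eq. (4.9) on vertical strips** (`k ≥ 1`): for real `a ≤ b` there are `K′, c > 0` and `y₁`
with `c e^{−K′ Im s} ≤ ‖γ_t(s)‖` whenever `a ≤ Re s ≤ b`, `Im s ≥ y₁` — Lemma 1 (lower half, `θ = 0`,
`Literature.NumberTheory.LFunctions.dobner_lemma1_holds`) for `γ(s)`, times the lower bound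
`e^{−π²|t|(∑ωᵢ)²/4}` for the Gaussian factor. [cite: Dobner2021, §4.1 eq. (4.9), p. 14] -/
theorem exists_exp_neg_mul_le_norm_dobnerGammaT_of_re_mem (hk : 0 < D.numGamma) (t : ℝ) (a b : ℝ) :
    ∃ K' y₁ c : ℝ, 0 < K' ∧ 0 < c ∧ ∀ s : ℂ, a ≤ s.re → s.re ≤ b → y₁ ≤ s.im →
      c * Real.exp (-(K' * s.im)) ≤ ‖D.dobnerGammaT t s‖ := by
  set Dd : ℝ := max |a| |b| + 1 with hDd
  have hDd0 : 0 < Dd := by positivity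
  obtain ⟨K, K', T₀, -, hK', hγ⟩ := dobner_lemma1_holds D.alpha D.polarOrder D.Q D.numGamma D.omega
    D.mu D.alpha_ne_zero D.Q_pos hk D.omega_pos D.mu_re_nonneg Dd 0 hDd0 le_rfl one_pos
  set c : ℝ := Real.exp (-(Real.pi ^ 2 * |t| * D.omegaSum ^ 2 / 4)) with hc
  refine ⟨K', max T₀ 0, c, hK', Real.exp_pos _, fun s ha hb hy ↦ ?_⟩
  have hy0 : 0 ≤ s.im := (le_max_right _ _).trans hy
  have hyT : T₀ ≤ |s.im| := by rw [abs_of_nonneg hy0]; exact (le_max_left _ _).trans hy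
  have hx : |s.re| ≤ Dd * |s.im| ^ (0 : ℝ) := by
    rw [Real.rpow_zero, mul_one, hDd, abs_le]
    constructor
    · linarith [neg_abs_le a, le_max_left |a| |b|]
    · linarith [le_abs_self b, le_max_right |a| |b|]
  have h1 := (hγ s hx hyT).1
  rw [abs_of_nonneg hy0] at h1
  rw [D.norm_dobnerGammaT, mul_comm]
  refine mul_le_mul ?_ (Real.exp_le_exp.2 (D.re_sq_sub_dobnerJ_div_ge t s)) (Real.exp_pos _).le
    (norm_nonneg _)
  exact h1

/-! ### The two term-wise bounds of §4.1 (with the weight `‖aₙ‖ ≤ C_a n²`) -/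

/-- `n² · n^{−p} ≤ n^{−2} 2^{−(p−4)}` for `n ≥ 2`, `p ≥ 4`. [cite: Dobner2021, §4.1 p. 13 ("converges for all large y")] -/
private theorem sq_mul_rpow_neg_le {n : ℕ} (hn : 2 ≤ n) {p : ℝ} (hp : 4 ≤ p) :
    (n : ℝ) ^ 2 * (n : ℝ) ^ (-p) ≤ (n : ℝ) ^ (-2 : ℝ) * (2 : ℝ) ^ (-(p - 4)) := by
  have hnpos : (0 : ℝ) < n := by exact_mod_cast (show 0 < n by omega)
  have e : (n : ℝ) ^ 2 * (n : ℝ) ^ (-p) = (n : ℝ) ^ (-(p - 2)) := by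
    rw [show ((n : ℝ) ^ 2) = (n : ℝ) ^ (2 : ℝ) by norm_cast, ← Real.rpow_add hnpos]
    congr 1; ring
  rw [e]
  have h := rpow_neg_le_inv_sq_mul hn (show 2 ≤ p - 2 by linarith)
  have e2 : p - 2 - 2 = p - 4 := by ring
  rwa [e2] at h

/-- **Small and medium `n`** (Lemma 4 (i), (ii)): for `1 ≤ n` with `log n ≤ y^{3/5}/|t|`,
`‖aₙ(B_{t,n} − main)‖ ≤ |γ_t| (K y^{−1/5} |termₐ(F_t) n| + C_a (K+1) n^{−2} 2^{−(p−4)})`,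
`p = y^{1/3}/8 − C ≥ 4`. [cite: Dobner2021, §4.1 p. 13] -/
theorem norm_coeff_mul_sub_le_small {t : ℝ} (ht : t < 0) {s : ℂ} (hs0 : s ≠ 0)
    {K C a Ca : ℝ} (hK : 0 < K) (hCa : 0 < Ca) (hcoeff : ∀ n : ℕ, n ≠ 0 → ‖D.coeff n‖ ≤ Ca * (n : ℝ) ^ 2)
    (hxC : -C < s.re) (ha : a ≤ s.re) (hy : 0 < s.im) {n : ℕ} (hn : 1 ≤ n)
    (hi : Real.log n ≤ s.im ^ (1 / 3 : ℝ) / |t| →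
      ‖D.dobnerB t n s - D.dobnerMainTerm t n s‖ ≤ K * s.im ^ (-(1 / 5 : ℝ)) * ‖D.dobnerMainTerm t n s‖)
    (hii : Real.log n ≤ s.im ^ (3 / 5 : ℝ) / |t| →
      ‖D.dobnerB t n s‖ ≤ K * ‖D.dobnerGammaT t s‖ * Real.exp (-(|t| / 8) * Real.log n ^ 2) *
        (n : ℝ) ^ (-s.re))
    (hlog35 : Real.log n ≤ s.im ^ (3 / 5 : ℝ) / |t|) (hp4 : 4 ≤ s.im ^ (1 / 3 : ℝ) / 8 - C) :
    ‖D.coeff n * (D.dobnerB t n s - D.dobnerMainTerm t n s)‖ ≤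
      ‖D.dobnerGammaT t s‖ * (K * s.im ^ (-(1 / 5 : ℝ)) * ‖LSeries.term (D.deformedCoeff t) a n‖) +
      ‖D.dobnerGammaT t s‖ * (Ca * (K + 1) * ((n : ℝ) ^ (-2 : ℝ) *
        (2 : ℝ) ^ (-(s.im ^ (1 / 3 : ℝ) / 8 - C - 4)))) := by
  have ht' : 0 < |t| := abs_pos.2 ht.ne
  set γn : ℝ := ‖D.dobnerGammaT t s‖ with hγn
  have hγ0 : 0 ≤ γn := norm_nonneg _
  set p : ℝ := s.im ^ (1 / 3 : ℝ) / 8 - C with hp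
  have hnpos : (0 : ℝ) < n := by exact_mod_cast hn
  have hn0 : n ≠ 0 := by omega
  have han := hcoeff n hn0
  have hT1 : 0 ≤ γn * (K * s.im ^ (-(1 / 5 : ℝ)) * ‖LSeries.term (D.deformedCoeff t) a n‖) := by
    positivity
  have hT2 : 0 ≤ γn * (Ca * (K + 1) * ((n : ℝ) ^ (-2 : ℝ) * (2 : ℝ) ^ (-(p - 4)))) := by positivity
  by_cases hsmall : Real.log n ≤ s.im ^ (1 / 3 : ℝ) / |t|
  · have h := hi hsmall
    calc ‖D.coeff n * (D.dobnerB t n s - D.dobnerMainTerm t n s)‖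
        = ‖D.coeff n‖ * ‖D.dobnerB t n s - D.dobnerMainTerm t n s‖ := norm_mul _ _
      _ ≤ ‖D.coeff n‖ * (K * s.im ^ (-(1 / 5 : ℝ)) * ‖D.dobnerMainTerm t n s‖) :=
          mul_le_mul_of_nonneg_left h (norm_nonneg _)
      _ = K * s.im ^ (-(1 / 5 : ℝ)) * ‖D.coeff n * D.dobnerMainTerm t n s‖ := by rw [norm_mul]; ring
      _ ≤ K * s.im ^ (-(1 / 5 : ℝ)) * (γn * ‖LSeries.term (D.deformedCoeff t) a n‖) :=
          mul_le_mul_of_nonneg_left (D.norm_coeff_mul_dobnerMainTerm_le ht hs0 ha n) (by positivity)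
      _ = γn * (K * s.im ^ (-(1 / 5 : ℝ)) * ‖LSeries.term (D.deformedCoeff t) a n‖) := by ring
      _ ≤ _ := le_add_of_nonneg_right hT2
  · push Not at hsmall
    have hn2 : 2 ≤ n := by
      by_contra h2
      have : n = 1 := by omega
      subst this
      simp at hsmall
      linarith [show 0 ≤ s.im ^ (1 / 3 : ℝ) / |t| by positivity]
    have hBn := hii hlog35
    have hmnn : ‖D.dobnerMainTerm t n s‖ ≤
        γn * (Real.exp (-(|t| / 8) * Real.log n ^ 2) * (n : ℝ) ^ (-s.re)) := by
      rw [D.norm_dobnerMainTerm t s hn]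
      refine mul_le_mul_of_nonneg_left (mul_le_mul_of_nonneg_right (Real.exp_le_exp.2 ?_)
        (Real.rpow_nonneg hnpos.le _)) hγ0
      nlinarith [sq_nonneg (Real.log n)]
    have hexp : (n : ℝ) ^ 2 * (Real.exp (-(|t| / 8) * Real.log n ^ 2) * (n : ℝ) ^ (-s.re)) ≤
        (n : ℝ) ^ (-2 : ℝ) * (2 : ℝ) ^ (-(p - 4)) := by
      rw [exp_neg_mul_log_sq_mul_rpow hn]
      have h1 : (n : ℝ) ^ (-(|t| / 8 * Real.log n + s.re)) ≤ (n : ℝ) ^ (-p) := by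
        refine Real.rpow_le_rpow_of_exponent_le (by exact_mod_cast hn) ?_
        have : s.im ^ (1 / 3 : ℝ) / 8 < |t| / 8 * Real.log n := by
          have := mul_lt_mul_of_pos_left hsmall (by positivity : (0 : ℝ) < |t| / 8)
          rwa [show |t| / 8 * (s.im ^ (1 / 3 : ℝ) / |t|) = s.im ^ (1 / 3 : ℝ) / 8 by field_simp] at this
        rw [hp]; linarith
      calc (n : ℝ) ^ 2 * (n : ℝ) ^ (-(|t| / 8 * Real.log n + s.re))
          ≤ (n : ℝ) ^ 2 * (n : ℝ) ^ (-p) := mul_le_mul_of_nonneg_left h1 (by positivity)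
        _ ≤ _ := sq_mul_rpow_neg_le hn2 hp4
    calc ‖D.coeff n * (D.dobnerB t n s - D.dobnerMainTerm t n s)‖
        = ‖D.coeff n‖ * ‖D.dobnerB t n s - D.dobnerMainTerm t n s‖ := norm_mul _ _
      _ ≤ (Ca * (n : ℝ) ^ 2) * (‖D.dobnerB t n s‖ + ‖D.dobnerMainTerm t n s‖) :=
          mul_le_mul han (norm_sub_le _ _) (norm_nonneg _) (by positivity)
      _ ≤ (Ca * (n : ℝ) ^ 2) * (K * γn * Real.exp (-(|t| / 8) * Real.log n ^ 2) * (n : ℝ) ^ (-s.re) +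
          γn * (Real.exp (-(|t| / 8) * Real.log n ^ 2) * (n : ℝ) ^ (-s.re))) :=
          mul_le_mul_of_nonneg_left (add_le_add hBn hmnn) (by positivity)
      _ = Ca * (K + 1) * γn *
          ((n : ℝ) ^ 2 * (Real.exp (-(|t| / 8) * Real.log n ^ 2) * (n : ℝ) ^ (-s.re))) := by ring
      _ ≤ Ca * (K + 1) * γn * ((n : ℝ) ^ (-2 : ℝ) * (2 : ℝ) ^ (-(p - 4))) :=
          mul_le_mul_of_nonneg_left hexp (by positivity)
      _ = γn * (Ca * (K + 1) * ((n : ℝ) ^ (-2 : ℝ) * (2 : ℝ) ^ (-(p - 4)))) := by ring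
      _ ≤ _ := le_add_of_nonneg_left hT1

/-- **Large `n`** (Lemma 4 (iii)): for `n > e^{y^{3/5}/|t|}`,
`‖aₙ(B_{t,n} − main)‖ ≤ C_a K n^{−2} e^{−(r−4) y^{3/5}/|t|} + C_a |γ_t| n^{−2} 2^{−(q−4)}`,
`r = y^{3/5}/10 ≥ 4`, `q = y^{3/5}/4 − C ≥ 4`. [cite: Dobner2021, §4.1 pp. 13–14] -/
theorem norm_coeff_mul_sub_le_large {t : ℝ} (ht : t < 0) {s : ℂ}
    {K C Ca : ℝ} (hK : 0 < K) (hCa : 0 < Ca) (hcoeff : ∀ n : ℕ, n ≠ 0 → ‖D.coeff n‖ ≤ Ca * (n : ℝ) ^ 2)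
    (hxC : -C < s.re) (hy : 0 < s.im) {n : ℕ}
    (hngt : Real.exp (s.im ^ (3 / 5 : ℝ) / |t|) < n)
    (hiii : s.im ^ (3 / 5 : ℝ) / |t| < Real.log n →
      ‖D.dobnerB t n s‖ ≤ K * Real.exp (-(|t| / 10) * Real.log n ^ 2))
    (hr4 : 4 ≤ s.im ^ (3 / 5 : ℝ) / 10) (hq4 : 4 ≤ s.im ^ (3 / 5 : ℝ) / 4 - C) :
    ‖D.coeff n * (D.dobnerB t n s - D.dobnerMainTerm t n s)‖ ≤
      Ca * K * ((n : ℝ) ^ (-2 : ℝ) *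
        Real.exp (-(s.im ^ (3 / 5 : ℝ) / 10 - 4) * (s.im ^ (3 / 5 : ℝ) / |t|))) +
      ‖D.dobnerGammaT t s‖ * (Ca * ((n : ℝ) ^ (-2 : ℝ) *
        (2 : ℝ) ^ (-(s.im ^ (3 / 5 : ℝ) / 4 - C - 4)))) := by
  have ht' : 0 < |t| := abs_pos.2 ht.ne
  set γn : ℝ := ‖D.dobnerGammaT t s‖ with hγn
  have hγ0 : 0 ≤ γn := norm_nonneg _
  set r : ℝ := s.im ^ (3 / 5 : ℝ) / 10 with hr
  set q : ℝ := s.im ^ (3 / 5 : ℝ) / 4 - C with hq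
  have hexp1 : 1 ≤ Real.exp (s.im ^ (3 / 5 : ℝ) / |t|) := Real.one_le_exp (by positivity)
  have hn1' : (1 : ℝ) < n := hexp1.trans_lt hngt
  have hn2 : 2 ≤ n := by exact_mod_cast hn1'
  have hn : 1 ≤ n := by omega
  have hn0 : n ≠ 0 := by omega
  have han := hcoeff n hn0
  have hnpos : (0 : ℝ) < n := by exact_mod_cast hn
  have hlog : s.im ^ (3 / 5 : ℝ) / |t| < Real.log n := (Real.lt_log_iff_exp_lt hnpos).2 hngt
  have hBn := hiii hlog
  have h1 : (n : ℝ) ^ 2 * Real.exp (-(|t| / 10) * Real.log n ^ 2) ≤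
      (n : ℝ) ^ (-2 : ℝ) * Real.exp (-(r - 4) * (s.im ^ (3 / 5 : ℝ) / |t|)) := by
    rw [exp_neg_mul_log_sq hn]
    have hrl : r < |t| / 10 * Real.log n := by
      have := mul_lt_mul_of_pos_left hlog (by positivity : (0 : ℝ) < |t| / 10)
      rwa [show |t| / 10 * (s.im ^ (3 / 5 : ℝ) / |t|) = r by rw [hr]; field_simp] at this
    have e2 : ((n : ℝ) ^ 2) = (n : ℝ) ^ (2 : ℝ) := by norm_cast
    calc (n : ℝ) ^ 2 * (n : ℝ) ^ (-(|t| / 10) * Real.log n)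
        ≤ (n : ℝ) ^ 2 * (n : ℝ) ^ (-r) :=
          mul_le_mul_of_nonneg_left (Real.rpow_le_rpow_of_exponent_le (by exact_mod_cast hn)
            (by linarith)) (by positivity)
      _ = (n : ℝ) ^ (-2 : ℝ) * (n : ℝ) ^ (-(r - 4)) := by
          rw [e2, ← Real.rpow_add hnpos, ← Real.rpow_add hnpos]; congr 1; ring
      _ ≤ (n : ℝ) ^ (-2 : ℝ) * (Real.exp (s.im ^ (3 / 5 : ℝ) / |t|)) ^ (-(r - 4)) := by
          refine mul_le_mul_of_nonneg_left ?_ (Real.rpow_nonneg hnpos.le _)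
          exact Real.rpow_le_rpow_of_nonpos (Real.exp_pos _) hngt.le (by linarith)
      _ = (n : ℝ) ^ (-2 : ℝ) * Real.exp (-(r - 4) * (s.im ^ (3 / 5 : ℝ) / |t|)) := by
          rw [← Real.exp_mul]; congr 1; congr 1; ring
  have h2 : (n : ℝ) ^ 2 * ‖D.dobnerMainTerm t n s‖ ≤ γn * ((n : ℝ) ^ (-2 : ℝ) * (2 : ℝ) ^ (-(q - 4))) := by
    rw [D.norm_dobnerMainTerm t s hn, exp_neg_mul_log_sq_mul_rpow hn, mul_left_comm]
    refine mul_le_mul_of_nonneg_left ?_ hγ0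
    have hq' : (n : ℝ) ^ (-(|t| / 4 * Real.log n + s.re)) ≤ (n : ℝ) ^ (-q) := by
      refine Real.rpow_le_rpow_of_exponent_le (by exact_mod_cast hn) ?_
      have : s.im ^ (3 / 5 : ℝ) / 4 < |t| / 4 * Real.log n := by
        have := mul_lt_mul_of_pos_left hlog (by positivity : (0 : ℝ) < |t| / 4)
        rwa [show |t| / 4 * (s.im ^ (3 / 5 : ℝ) / |t|) = s.im ^ (3 / 5 : ℝ) / 4 by field_simp] at this
      rw [hq]; linarith
    calc (n : ℝ) ^ 2 * (n : ℝ) ^ (-(|t| / 4 * Real.log n + s.re))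
        ≤ (n : ℝ) ^ 2 * (n : ℝ) ^ (-q) := mul_le_mul_of_nonneg_left hq' (by positivity)
      _ ≤ _ := sq_mul_rpow_neg_le hn2 hq4
  calc ‖D.coeff n * (D.dobnerB t n s - D.dobnerMainTerm t n s)‖
      = ‖D.coeff n‖ * ‖D.dobnerB t n s - D.dobnerMainTerm t n s‖ := norm_mul _ _
    _ ≤ (Ca * (n : ℝ) ^ 2) * (‖D.dobnerB t n s‖ + ‖D.dobnerMainTerm t n s‖) :=
        mul_le_mul han (norm_sub_le _ _) (norm_nonneg _) (by positivity)
    _ ≤ (Ca * (n : ℝ) ^ 2) * (K * Real.exp (-(|t| / 10) * Real.log n ^ 2) + ‖D.dobnerMainTerm t n s‖) := by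
        gcongr
    _ = Ca * K * ((n : ℝ) ^ 2 * Real.exp (-(|t| / 10) * Real.log n ^ 2)) +
        Ca * ((n : ℝ) ^ 2 * ‖D.dobnerMainTerm t n s‖) := by ring
    _ ≤ Ca * K * ((n : ℝ) ^ (-2 : ℝ) * Real.exp (-(r - 4) * (s.im ^ (3 / 5 : ℝ) / |t|))) +
        Ca * (γn * ((n : ℝ) ^ (-2 : ℝ) * (2 : ℝ) ^ (-(q - 4)))) := by
        gcongr
    _ = _ := by ring

/-! ### Thm. 4 (qualitative) from Lemma 4♯ — the reduction -/

/-- The exponent of the large-`n` tail tends to `−∞` (shifted form):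
`K′ y − (y^{3/5}/10 − 4)(y^{3/5}/|t|) → −∞`. [cite: Dobner2021, §4.1 p. 14 ("the second term dominates")] -/
private theorem tendsto_large_tail_exponent_four {K' τ : ℝ} (hτ : 0 < τ) :
    Tendsto (fun y : ℝ ↦ K' * y - (y ^ (3 / 5 : ℝ) / 10 - 4) * (y ^ (3 / 5 : ℝ) / τ)) atTop atBot := by
  have h := tendsto_large_tail_exponent (K' := K' + 2 / τ) hτ
  refine tendsto_atBot_mono' atTop ?_ h
  filter_upwards [eventually_ge_atTop (1 : ℝ)] with y hy1
  have hy0 : 0 < y := by linarith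
  have e35 : y ^ (3 / 5 : ℝ) ≤ y := by
    conv_rhs => rw [← Real.rpow_one y]
    exact Real.rpow_le_rpow_of_exponent_le hy1 (by norm_num)
  have h2 : 2 * (y ^ (3 / 5 : ℝ) / τ) ≤ 2 / τ * y := by
    rw [div_mul_eq_mul_div, mul_div_assoc]
    exact mul_le_mul_of_nonneg_left (div_le_div_of_nonneg_right e35 hτ.le) (by norm_num)
  have e : K' * y - (y ^ (3 / 5 : ℝ) / 10 - 4) * (y ^ (3 / 5 : ℝ) / τ) =
      (K' * y + 2 * (y ^ (3 / 5 : ℝ) / τ)) - (y ^ (3 / 5 : ℝ) / 10 - 2) * (y ^ (3 / 5 : ℝ) / τ) := by ring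
  rw [e]
  have e' : (K' + 2 / τ) * y = K' * y + 2 / τ * y := by ring
  rw [e']
  linarith

set_option maxHeartbeats 800000 in
/-- **Dobner's Thm. 4 for `F ∈ 𝒮♯`, qualitative version, from Lemma 4♯ (hypothesis `hL4` = the frozen
statement of `ExtendedSelbergDatum.dobner_lemma4` for this `D`, `t`, every `C > 0`) and the series
representation `ξ^F_t(J_t(s)) = ∑ aₙ B_{t,n}(s)` (N1-a)** — §4.1 of the source: split at
`log n = y^{1/3}/|t|` and `log n = y^{3/5}/|t|`; Lemma 4 (i) controls the small `n` by
`y^{−1/5} F̃_t(a)`, (ii) the medium `n` by a tail `C_a ∑ n^{2−(y^{1/3}/8 − C)}`, (iii) the large `n` by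
`C_a e^{−(y^{3/5}/10 − 4) y^{3/5}/|t|}`, which after division by `|γ_t(s)| ≥ c e^{−K′y}` (eq. (4.9),
`exists_exp_neg_mul_le_norm_dobnerGammaT_of_re_mem`) still tends to `0`. The hypothesis-free
`ExtendedSelbergDatum.xiDeformed_approx` is `xiDeformed_approx_of D hk ht (fun C hC ↦ …lemma4…)`.
[cite: Dobner2021, Thm. 4, p. 8; §4.1 pp. 13–14] -/
theorem xiDeformed_approx_of (hk : 0 < D.numGamma) {t : ℝ} (ht : t < 0)
    (hL4 : ∀ C : ℝ, 0 < C → ∃ y₀ K : ℝ, 0 < K ∧ ∀ s : ℂ, |s.re| ≤ C * s.im ^ (1 / 4 : ℝ) →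
      y₀ ≤ s.im → ∀ n : ℕ, 1 ≤ n →
        (Real.log n ≤ s.im ^ (1 / 3 : ℝ) / |t| →
          ‖D.dobnerB t n s - D.dobnerMainTerm t n s‖ ≤
            K * s.im ^ (-(1 / 5 : ℝ)) * ‖D.dobnerMainTerm t n s‖) ∧
        (Real.log n ≤ s.im ^ (3 / 5 : ℝ) / |t| →
          ‖D.dobnerB t n s‖ ≤ K * ‖D.dobnerGammaT t s‖ * Real.exp (-(|t| / 8) * Real.log n ^ 2) *
            (n : ℝ) ^ (-s.re)) ∧
        (s.im ^ (3 / 5 : ℝ) / |t| < Real.log n →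
          ‖D.dobnerB t n s‖ ≤ K * Real.exp (-(|t| / 10) * Real.log n ^ 2)))
    (a b : ℝ) (hab : a ≤ b) {ε : ℝ} (hε : 0 < ε) :
    ∃ y₀ : ℝ, ∀ s : ℂ, a ≤ s.re → s.re ≤ b → y₀ ≤ s.im →
      ‖D.xiDeformed t (D.dobnerJ t s) - D.dobnerGammaT t s * D.Ft t s‖ ≤ ε * ‖D.dobnerGammaT t s‖ := by
  have ht' : 0 < |t| := abs_pos.2 ht.ne
  have _hab := hab
  -- constants
  set C : ℝ := max (max |a| |b|) 1 + 1 with hC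
  have hC1 : 1 ≤ C := by rw [hC]; linarith [le_max_right (max |a| |b|) 1]
  have hC0 : 0 < C := by linarith
  have hCa : |a| ≤ C - 1 := by rw [hC]; linarith [le_max_left |a| |b|, le_max_left (max |a| |b|) 1]
  have hCb : |b| ≤ C - 1 := by rw [hC]; linarith [le_max_right |a| |b|, le_max_left (max |a| |b|) 1]
  obtain ⟨y₁, K, hK, hL4'⟩ := hL4 C hC0
  obtain ⟨K₁', y₂, c₀, hK₁', hc₀pos, hL1⟩ := D.exists_exp_neg_mul_le_norm_dobnerGammaT_of_re_mem hk t a b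
  obtain ⟨Ca, hCa0, hcoeff⟩ := D.exists_norm_coeff_le
  set Z : ℝ := ∑' n : ℕ, ‖LSeries.term (D.deformedCoeff t) a n‖ with hZ
  have hZs : Summable fun n : ℕ ↦ ‖LSeries.term (D.deformedCoeff t) a n‖ :=
    (D.summable_deformedCoeff ht a).norm
  have hZ0 : 0 ≤ Z := tsum_nonneg fun n ↦ norm_nonneg _
  -- the error function
  obtain ⟨Err, hErr_def, hErr0⟩ : ∃ Err : ℝ → ℝ, (∀ y, Err y = K * Z * y ^ (-(1 / 5 : ℝ)) +
      2 * (Ca * (K + 1)) * (2 : ℝ) ^ (-(y ^ (1 / 3 : ℝ) / 8 - C - 4)) +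
      2 * Ca * (2 : ℝ) ^ (-(y ^ (3 / 5 : ℝ) / 4 - C - 4)) +
      2 * (Ca * K) / c₀ * Real.exp (K₁' * y - (y ^ (3 / 5 : ℝ) / 10 - 4) * (y ^ (3 / 5 : ℝ) / |t|))) ∧
      Tendsto Err atTop (𝓝 0) := by
    refine ⟨_, fun y ↦ rfl, ?_⟩
    have e1 := (tendsto_rpow_neg_atTop (by norm_num : (0 : ℝ) < 1 / 5)).const_mul (K * Z)
    have e2 := (tendsto_two_rpow_neg (by norm_num : (0 : ℝ) < 1 / 3) (by norm_num : (0 : ℝ) < 8)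
      (C + 4)).const_mul (2 * (Ca * (K + 1)))
    have e3 := (tendsto_two_rpow_neg (by norm_num : (0 : ℝ) < 3 / 5) (by norm_num : (0 : ℝ) < 4)
      (C + 4)).const_mul (2 * Ca)
    have e4 := (Real.tendsto_exp_atBot.comp (tendsto_large_tail_exponent_four (K' := K₁') ht')).const_mul
      (2 * (Ca * K) / c₀)
    simp only [mul_zero] at e1 e2 e3 e4
    have := ((e1.add e2).add e3).add e4
    simp only [add_zero] at this
    refine this.congr fun y ↦ ?_
    simp only [Function.comp]
    ring_nf
  -- thresholds
  have hev : ∀ᶠ y : ℝ in atTop, Err y < ε ∧ y₁ ≤ y ∧ y₂ ≤ y ∧ 1 ≤ y ∧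
      4 ≤ y ^ (1 / 3 : ℝ) / 8 - C ∧ 4 ≤ y ^ (3 / 5 : ℝ) / 4 - C ∧ 4 ≤ y ^ (3 / 5 : ℝ) / 10 := by
    have t13 : Tendsto (fun y : ℝ ↦ y ^ (1 / 3 : ℝ) / 8 - C) atTop atTop :=
      tendsto_atTop_add_const_right _ _ ((tendsto_rpow_atTop (by norm_num)).atTop_div_const (by norm_num))
    have t35 : Tendsto (fun y : ℝ ↦ y ^ (3 / 5 : ℝ) / 4 - C) atTop atTop :=
      tendsto_atTop_add_const_right _ _ ((tendsto_rpow_atTop (by norm_num)).atTop_div_const (by norm_num))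
    have t35' : Tendsto (fun y : ℝ ↦ y ^ (3 / 5 : ℝ) / 10) atTop atTop :=
      (tendsto_rpow_atTop (by norm_num)).atTop_div_const (by norm_num)
    filter_upwards [hErr0.eventually (gt_mem_nhds hε), eventually_ge_atTop y₁, eventually_ge_atTop y₂,
      eventually_ge_atTop (1 : ℝ), t13.eventually_ge_atTop 4, t35.eventually_ge_atTop 4,
      t35'.eventually_ge_atTop 4] with y h1 h2 h3 h4 h5 h6 h7
    exact ⟨h1, h2, h3, h4, h5, h6, h7⟩
  obtain ⟨y₀, hy₀⟩ := eventually_atTop.1 hev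
  refine ⟨y₀, fun s hsa hsb hsy ↦ ?_⟩
  -- fix `s = x + iy`
  set x : ℝ := s.re with hx
  set y : ℝ := s.im with hy
  obtain ⟨hErrε, hyy₁, hyy₂, hy1, hp4, hq4, hr4⟩ := hy₀ y hsy
  have hy0 : 0 < y := by linarith
  have hs0 : s ≠ 0 := fun h ↦ by
    have : y = 0 := by rw [hy, h]; simp
    linarith
  have hxC' : |x| ≤ C - 1 := by
    rw [abs_le]; rw [abs_le] at hCa hCb; constructor <;> linarith
  have hxC : |x| ≤ C * y ^ (1 / 4 : ℝ) := by
    have h1 : (1 : ℝ) ≤ y ^ (1 / 4 : ℝ) := Real.one_le_rpow hy1 (by norm_num)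
    have h2 : C * 1 ≤ C * y ^ (1 / 4 : ℝ) := mul_le_mul_of_nonneg_left h1 hC0.le
    linarith
  -- Lemma 4 at `s` and the lower bound for `γ_t(s)`
  have hL4s := hL4' s hxC hyy₁
  set γn : ℝ := ‖D.dobnerGammaT t s‖ with hγn
  have hγt : c₀ * Real.exp (-(K₁' * y)) ≤ γn := hL1 s hsa hsb hyy₂
  have hγpos : 0 < γn := lt_of_lt_of_le (by positivity) hγt
  -- the pieces of the sum
  set mn : ℕ → ℂ := fun n ↦ D.coeff n * D.dobnerMainTerm t n s with hmn
  set B : ℕ → ℂ := fun n ↦ D.coeff n * D.dobnerB t n s with hB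
  set d : ℕ → ℂ := fun n ↦ D.coeff n * (D.dobnerB t n s - D.dobnerMainTerm t n s) with hd
  have hmn_fun : mn = fun n ↦ D.dobnerGammaT t s * LSeries.term (D.deformedCoeff t) s n :=
    funext fun n ↦ D.coeff_mul_dobnerMainTerm_eq ht n hs0
  have hmn_sum : Summable mn := by rw [hmn_fun]; exact (D.summable_deformedCoeff ht s).mul_left _
  have hmn_tsum : ∑' n, mn n = D.dobnerGammaT t s * D.Ft t s := by
    rw [hmn_fun, tsum_mul_left, Ft_apply, LSeries]
  -- exponents and the cut-off `N₂`
  set N₂ : ℕ := ⌊Real.exp (y ^ (3 / 5 : ℝ) / |t|)⌋₊ with hN₂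
  have hxge : -C < x := by linarith [(abs_le.1 hxC').1]
  have hsa' : a ≤ s.re := hsa
  -- (A) the terms with `n ≤ N₂`
  have hA : ∀ n : ℕ, n ≤ N₂ → ‖d n‖ ≤
      γn * (K * y ^ (-(1 / 5 : ℝ)) * ‖LSeries.term (D.deformedCoeff t) a n‖) +
      γn * (Ca * (K + 1) * ((n : ℝ) ^ (-2 : ℝ) * (2 : ℝ) ^ (-(y ^ (1 / 3 : ℝ) / 8 - C - 4)))) := by
    intro n hnN
    rcases Nat.eq_zero_or_pos n with rfl | hn
    · have : d 0 = 0 := by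
        simp only [hd, D.dobnerB_zero t s]
        rw [D.dobnerMainTerm_eq ht 0 hs0]
        simp
      rw [this, norm_zero]
      positivity
    have hlog35 : Real.log n ≤ y ^ (3 / 5 : ℝ) / |t| := by
      rw [Real.log_le_iff_le_exp (by exact_mod_cast hn)]
      exact (show (n : ℝ) ≤ N₂ by exact_mod_cast hnN).trans (Nat.floor_le (by positivity))
    obtain ⟨hi, hii, -⟩ := hL4s n hn
    exact D.norm_coeff_mul_sub_le_small ht hs0 hK hCa0 hcoeff hxge hsa' hy0 hn hi hii hlog35 hp4
  -- (B) the terms with `n > N₂`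
  set E₃ : ℝ := Real.exp (-(y ^ (3 / 5 : ℝ) / 10 - 4) * (y ^ (3 / 5 : ℝ) / |t|)) with hE₃
  have hBB : ∀ m : ℕ, ‖d (m + (N₂ + 1))‖ ≤
      Ca * K * (((m + (N₂ + 1) : ℕ) : ℝ) ^ (-2 : ℝ) * E₃) +
      γn * (Ca * ((((m + (N₂ + 1) : ℕ) : ℝ) ^ (-2 : ℝ)) * (2 : ℝ) ^ (-(y ^ (3 / 5 : ℝ) / 4 - C - 4)))) := by
    intro m
    have hngt : Real.exp (y ^ (3 / 5 : ℝ) / |t|) < ((m + (N₂ + 1) : ℕ) : ℝ) := by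
      refine (Nat.lt_floor_add_one (Real.exp (y ^ (3 / 5 : ℝ) / |t|))).trans_le ?_
      rw [← hN₂]; exact_mod_cast (show N₂ + 1 ≤ m + (N₂ + 1) by omega)
    obtain ⟨-, -, hiii⟩ := hL4s (m + (N₂ + 1)) (by omega)
    exact D.norm_coeff_mul_sub_le_large ht hK hCa0 hcoeff hxge hy0 hngt hiii hr4 hq4
  -- summability of `‖d‖`
  have hsq2 : Summable fun m : ℕ ↦ (((m + (N₂ + 1) : ℕ) : ℝ) ^ (-2 : ℝ)) :=
    (summable_nat_add_iff (N₂ + 1)).2 summable_nat_rpow_neg_two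
  have hdn_tail : Summable fun m : ℕ ↦ ‖d (m + (N₂ + 1))‖ :=
    Summable.of_nonneg_of_le (fun m ↦ norm_nonneg _) hBB
      (((hsq2.mul_right E₃).mul_left (Ca * K)).add (((hsq2.mul_right _).mul_left Ca).mul_left γn))
  have hdn : Summable fun n : ℕ ↦ ‖d n‖ := (summable_nat_add_iff (N₂ + 1)).1 hdn_tail
  have hds : Summable d := hdn.of_norm
  -- the identity `ξ_t(J) − γ_t F_t = Σ d`
  have hBs : Summable B := by
    have : B = fun n ↦ d n + mn n := by funext n; simp only [hd, hB, hmn]; ring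
    rw [this]; exact hds.add hmn_sum
  have hrepr := D.xiDeformed_dobnerJ_eq_tsum hk ht s
  have hdiff : D.xiDeformed t (D.dobnerJ t s) - D.dobnerGammaT t s * D.Ft t s = ∑' n, d n := by
    rw [hrepr, ← hmn_tsum, ← Summable.tsum_sub hBs hmn_sum]
    refine tsum_congr fun n ↦ ?_
    simp only [hB, hmn, hd]
    ring
  -- estimate
  rw [hdiff]
  have hsplit := hdn.sum_add_tsum_nat_add (N₂ + 1)
  have hZpart : ∑ n ∈ Finset.range (N₂ + 1), ‖LSeries.term (D.deformedCoeff t) a n‖ ≤ Z :=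
    hZs.sum_le_tsum _ fun n _ ↦ norm_nonneg _
  have h2part : ∑ n ∈ Finset.range (N₂ + 1), (n : ℝ) ^ (-2 : ℝ) ≤ 2 :=
    (summable_nat_rpow_neg_two.sum_le_tsum _ fun n _ ↦ Real.rpow_nonneg n.cast_nonneg _).trans
      tsum_nat_rpow_neg_two_le
  have h2tail : ∑' m : ℕ, (((m + (N₂ + 1) : ℕ) : ℝ) ^ (-2 : ℝ)) ≤ 2 := by
    have h := summable_nat_rpow_neg_two.sum_add_tsum_nat_add (N₂ + 1)
    have hnn : 0 ≤ ∑ n ∈ Finset.range (N₂ + 1), (n : ℝ) ^ (-2 : ℝ) :=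
      Finset.sum_nonneg fun n _ ↦ Real.rpow_nonneg n.cast_nonneg _
    linarith [tsum_nat_rpow_neg_two_le]
  have hhead : ∑ n ∈ Finset.range (N₂ + 1), ‖d n‖ ≤
      γn * (K * y ^ (-(1 / 5 : ℝ)) * Z) +
      γn * (Ca * (K + 1) * (2 * (2 : ℝ) ^ (-(y ^ (1 / 3 : ℝ) / 8 - C - 4)))) := by
    calc ∑ n ∈ Finset.range (N₂ + 1), ‖d n‖
        ≤ ∑ n ∈ Finset.range (N₂ + 1),
            (γn * (K * y ^ (-(1 / 5 : ℝ)) * ‖LSeries.term (D.deformedCoeff t) a n‖) +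
             γn * (Ca * (K + 1) * ((n : ℝ) ^ (-2 : ℝ) * (2 : ℝ) ^ (-(y ^ (1 / 3 : ℝ) / 8 - C - 4))))) :=
          Finset.sum_le_sum fun n hn ↦ hA n (by rw [Finset.mem_range] at hn; omega)
      _ = γn * (K * y ^ (-(1 / 5 : ℝ)) *
            ∑ n ∈ Finset.range (N₂ + 1), ‖LSeries.term (D.deformedCoeff t) a n‖) +
          γn * (Ca * (K + 1) * ((∑ n ∈ Finset.range (N₂ + 1), (n : ℝ) ^ (-2 : ℝ)) *
            (2 : ℝ) ^ (-(y ^ (1 / 3 : ℝ) / 8 - C - 4)))) := by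
          rw [Finset.sum_add_distrib, ← Finset.mul_sum, ← Finset.mul_sum, ← Finset.mul_sum,
            ← Finset.mul_sum, ← Finset.sum_mul]
      _ ≤ γn * (K * y ^ (-(1 / 5 : ℝ)) * Z) +
          γn * (Ca * (K + 1) * (2 * (2 : ℝ) ^ (-(y ^ (1 / 3 : ℝ) / 8 - C - 4)))) := by
          gcongr
  have htail : ∑' m : ℕ, ‖d (m + (N₂ + 1))‖ ≤
      Ca * K * (2 * E₃) + γn * (Ca * (2 * (2 : ℝ) ^ (-(y ^ (3 / 5 : ℝ) / 4 - C - 4)))) := by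
    calc ∑' m : ℕ, ‖d (m + (N₂ + 1))‖
        ≤ ∑' m : ℕ, (Ca * K * ((((m + (N₂ + 1) : ℕ) : ℝ) ^ (-2 : ℝ)) * E₃) +
            γn * (Ca * ((((m + (N₂ + 1) : ℕ) : ℝ) ^ (-2 : ℝ)) *
              (2 : ℝ) ^ (-(y ^ (3 / 5 : ℝ) / 4 - C - 4))))) :=
          Summable.tsum_le_tsum hBB hdn_tail
            (((hsq2.mul_right E₃).mul_left (Ca * K)).add
              (((hsq2.mul_right _).mul_left Ca).mul_left γn))
      _ = Ca * K * ((∑' m : ℕ, (((m + (N₂ + 1) : ℕ) : ℝ) ^ (-2 : ℝ))) * E₃) +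
          γn * (Ca * ((∑' m : ℕ, (((m + (N₂ + 1) : ℕ) : ℝ) ^ (-2 : ℝ))) *
            (2 : ℝ) ^ (-(y ^ (3 / 5 : ℝ) / 4 - C - 4)))) := by
          rw [Summable.tsum_add ((hsq2.mul_right E₃).mul_left (Ca * K))
            (((hsq2.mul_right _).mul_left Ca).mul_left γn),
            tsum_mul_left, tsum_mul_left, tsum_mul_left, tsum_mul_right, tsum_mul_right]
      _ ≤ Ca * K * (2 * E₃) + γn * (Ca * (2 * (2 : ℝ) ^ (-(y ^ (3 / 5 : ℝ) / 4 - C - 4)))) := by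
          gcongr
  -- divide the large-`n` bound by `γn`
  have hE₃γ : Ca * K * (2 * E₃) ≤ γn * (2 * (Ca * K) / c₀ *
      Real.exp (K₁' * y - (y ^ (3 / 5 : ℝ) / 10 - 4) * (y ^ (3 / 5 : ℝ) / |t|))) := by
    have e : Real.exp (K₁' * y - (y ^ (3 / 5 : ℝ) / 10 - 4) * (y ^ (3 / 5 : ℝ) / |t|)) =
        Real.exp (K₁' * y) * E₃ := by
      rw [hE₃, ← Real.exp_add]; congr 1; ring
    rw [e]
    have h1 : 1 ≤ γn * (Real.exp (K₁' * y) / c₀) := by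
      rw [mul_div_assoc', le_div_iff₀ hc₀pos, one_mul]
      calc c₀ = c₀ * Real.exp (-(K₁' * y)) * Real.exp (K₁' * y) := by
            rw [mul_assoc, ← Real.exp_add]; simp
        _ ≤ γn * Real.exp (K₁' * y) := mul_le_mul_of_nonneg_right hγt (Real.exp_pos _).le
    have hE0 : 0 ≤ E₃ := (Real.exp_pos _).le
    calc Ca * K * (2 * E₃) = Ca * K * (2 * E₃) * 1 := by ring
      _ ≤ Ca * K * (2 * E₃) * (γn * (Real.exp (K₁' * y) / c₀)) :=
          mul_le_mul_of_nonneg_left h1 (by positivity)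
      _ = γn * (2 * (Ca * K) / c₀ * (Real.exp (K₁' * y) * E₃)) := by
          field_simp
  -- conclusion
  have hErr_y := hErr_def y
  calc ‖∑' n, d n‖ ≤ ∑' n, ‖d n‖ := norm_tsum_le_tsum_norm hdn
    _ = ∑ n ∈ Finset.range (N₂ + 1), ‖d n‖ + ∑' m : ℕ, ‖d (m + (N₂ + 1))‖ := hsplit.symm
    _ ≤ γn * (K * y ^ (-(1 / 5 : ℝ)) * Z) +
          γn * (Ca * (K + 1) * (2 * (2 : ℝ) ^ (-(y ^ (1 / 3 : ℝ) / 8 - C - 4)))) +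
        (Ca * K * (2 * E₃) + γn * (Ca * (2 * (2 : ℝ) ^ (-(y ^ (3 / 5 : ℝ) / 4 - C - 4))))) :=
        add_le_add hhead htail
    _ ≤ γn * (K * y ^ (-(1 / 5 : ℝ)) * Z) +
          γn * (Ca * (K + 1) * (2 * (2 : ℝ) ^ (-(y ^ (1 / 3 : ℝ) / 8 - C - 4)))) +
        (γn * (2 * (Ca * K) / c₀ *
            Real.exp (K₁' * y - (y ^ (3 / 5 : ℝ) / 10 - 4) * (y ^ (3 / 5 : ℝ) / |t|))) +
          γn * (Ca * (2 * (2 : ℝ) ^ (-(y ^ (3 / 5 : ℝ) / 4 - C - 4))))) := by gcongr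
    _ = γn * Err y := by rw [hErr_y]; ring
    _ ≤ γn * ε := mul_le_mul_of_nonneg_left hErrε.le hγpos.le
    _ = ε * ‖D.dobnerGammaT t s‖ := by rw [hγn, mul_comm]

end ExtendedSelbergDatum

end Literature.NumberTheory.LFunctions

end
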